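import Literature.NumberTheory.IwasawaTheory.NarrowFukudaCertificateLayerTwoModel
import Literature.NumberTheory.IwasawaTheory.ClassGroupPRankLeOneOfAmbiguousLayerTwo
import HarnessLib

/-!
# `−1` is a norm from the second layer of the cyclotomic `ℤ₂`-extension of an odd-degree number field: `N_{K(θ)/K}(1 − θ) = −1` for
# `θ⁴ − 4θ² + 2 = 0` (`K_2 = K·ℚ(ζ₁₆)⁺`, `ℚ(ζ₁₆)⁺ = ℚ(θ)`, `θ = 2cos(π/8)`)

Topic `NumberTheory/IwasawaTheory` (namespace = path).  THEOREM-ONLY file (no definition, no named fact, no instance, no `sorry`), written by the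
prover seat `bsd-line-att-p3` g42 (cell `bsd-f1-sign2`, route `AlignedTransportAtTwo`; `--supports` stmt-BirchSwinnertonDyer-22298, closes nothing).  A piece of the
unit-norm-index hypothesis `[E_K : E_K ∩ N_{K_2/K} K_2ˣ] = 1` of the depth door (`ClassGroupPRankLeOneOfAmbiguousLayerTwo{,OddIndex}`, this seat): for a
complex cubic field `E_K = ⟨−1, ε⟩`, and the generator `−1` is ALWAYS a norm from the quartic layer.

* ★ `Algebra.norm_one_sub_eq_neg_one_of_quartic_root` — `[K:ℚ]` odd, `L/K` of degree `4`, `θ ∈ L` with `θ⁴ − 4θ² + 2 = 0` ⟹ `N_{L/K}(1 − θ) = −1`: `K⟮1 − θ⟯ = K⟮θ⟯ = L`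
  (tree `finrank_adjoin_quartic_root`), the minimal polynomial of `1 − θ` is `q = X⁴ − 4X³ + 2X² + 4X − 1 = p(1 − X)` (monic of degree `4` with `1 − θ` as a
  root), and `N = (−1)^4 · q(0) = p(1) = −1` (Mathlib `PowerBasis.norm_gen_eq_coeff_zero_minpoly`).
* ★★ `neg_one_mem_map_norm_layer_two` — for every cyclotomic `ℤ₂`-extension `κ` of `K` with `2 ∤ [K:ℚ]`: `−1 ∈ N_{K_2/K} K_2ˣ` in the tree's currency
  `unitsIncl K K_2 (−1) ∈ (⊤ : Subgroup K_2ˣ).map (Herbrand.norm Gal(K_2/K))` (`K_2 ∋ θ`, tree `exists_quartic_root_layer_two_of_not_dvd_finrank`;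
  `∏_σ σ(1−θ) = N(1−θ)`, Mathlib `Algebra.norm_eq_prod_automorphisms`).

(Remark, not formalised: `p_m(1) = 2cos(2^m π/3) = −1` for the minimal polynomial `p_m` of `2cos(π/2^{m+1})`, so `N_{K_m/K}(1 − θ_m) = −1` in EVERY layer
`m ≥ 1`.)  HONEST SCOPE: classical; nothing specific to any summit; BSD is not advanced by this file.

References: [Washington1997] §13.1 (`ℚ_n = ℚ(ζ_{2^{n+2}})⁺`, `K_n = K·ℚ_n`), §9 (cyclotomic units); [Lang1990] Ch. 13 §4 (unit norm index in Chevalley's formula);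
[NeukirchANT1999] Ch. IV §7 (norm groups).
-/

set_option autoImplicit false

noncomputable section

open scoped NumberField Polynomial IntermediateField
open NumberField Field Polynomial

namespace Literature.NumberTheory.IwasawaTheory

open Literature.NumberTheory.EllipticCurves Literature.NumberTheory.NumberFields
  Literature.NumberTheory.GaloisRepresentations Literature.NumberTheory.GaloisRepresentations.Herbrand
  Literature.NumberTheory.GaloisRepresentations.MinkowskiUnit Literature.NumberTheory.GaloisRepresentations.CyclicNormIndex

variable {K : Type} [Field K] [NumberField K]

/-! ## §1 `N_{L/K}(1 − θ) = −1` -/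

/-- ★ **`N_{L/K}(1 − θ) = −1`** for `[K:ℚ]` odd, `[L:K] = 4` and `θ ∈ L` with `θ⁴ − 4θ² + 2 = 0`: `K⟮1−θ⟯ = K⟮θ⟯ = L`, the minimal polynomial of `1 − θ` is
`X⁴ − 4X³ + 2X² + 4X − 1` (monic of degree `4 = [K⟮1−θ⟯ : K]` vanishing at `1 − θ`), whose constant coefficient is `−1 = p(1)`.
[cite: Washington1997, §13.1 (`[K_2 : K] = 4`, `ℚ_2 = ℚ(ζ₁₆)⁺`)] -/
theorem Algebra.norm_one_sub_eq_neg_one_of_quartic_root (hodd : Odd (Module.finrank ℚ K)) {L : Type*} [Field L] [Algebra K L]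
    [FiniteDimensional K L] (hL : Module.finrank K L = 4) (θ : L) (hθ : θ ^ 4 - 4 * θ ^ 2 + 2 = 0) :
    Algebra.norm K (1 - θ) = -1 := by
  have hintθ : IsIntegral K θ := Algebra.IsIntegral.isIntegral θ
  have hint : IsIntegral K (1 - θ) := Algebra.IsIntegral.isIntegral (1 - θ)
  -- `K⟮θ⟯ = ⊤` and `K⟮1 − θ⟯ = ⊤`
  have htopθ : K⟮θ⟯ = ⊤ := by
    apply IntermediateField.eq_of_le_of_finrank_eq le_top
    rw [finrank_adjoin_quartic_root hodd θ hθ, IntermediateField.finrank_top', hL]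
  have htop : K⟮1 - θ⟯ = ⊤ := by
    rw [eq_top_iff, ← htopθ, IntermediateField.adjoin_simple_le_iff]
    have h1 : (1 : L) - (1 - θ) ∈ K⟮1 - θ⟯ :=
      IntermediateField.sub_mem _ (IntermediateField.one_mem _) (IntermediateField.mem_adjoin_simple_self K (1 - θ))
    rwa [sub_sub_cancel] at h1
  have hdeg : Module.finrank K K⟮1 - θ⟯ = 4 := by rw [htop, IntermediateField.finrank_top', hL]
  -- the minimal polynomial of `1 − θ`
  set q : K[X] := X ^ 4 - C (4 : K) * X ^ 3 + C 2 * X ^ 2 + C 4 * X - C 1 with hq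
  have hqmonic : q.Monic := by rw [hq]; monicity!
  have hqdeg : q.natDegree = 4 := by rw [hq]; compute_degree!
  have hqroot : aeval (1 - θ) q = 0 := by
    rw [hq]
    simp only [map_sub, map_add, map_mul, map_pow, aeval_X, aeval_C]
    have : (algebraMap K L) 4 = 4 := map_ofNat _ 4
    have h2 : (algebraMap K L) 2 = 2 := map_ofNat _ 2
    rw [this, h2, map_one]
    linear_combination hθ
  have hmin : minpoly K (1 - θ) = q := by
    symm
    apply Polynomial.eq_of_monic_of_dvd_of_natDegree_le (minpoly.monic hint) hqmonic (minpoly.dvd K (1 - θ) hqroot)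
    rw [hqdeg, ← IntermediateField.adjoin.finrank hint, hdeg]
  have hq0 : q.coeff 0 = -1 := by rw [hq]; simp
  -- `N(1−θ) = N(gen)^{[L : K⟮1−θ⟯]} = ((−1)^4 · q(0))^1`
  rw [Algebra.norm_eq_norm_adjoin K (1 - θ)]
  have hpow : Module.finrank (↥K⟮1 - θ⟯) L = 1 := by rw [htop]; exact IntermediateField.finrank_top
  rw [hpow, pow_one]
  have hpb := Algebra.PowerBasis.norm_gen_eq_coeff_zero_minpoly (IntermediateField.adjoin.powerBasis hint)
  rw [IntermediateField.adjoin.powerBasis_gen, IntermediateField.minpoly_gen] at hpb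
  rw [hpb, hmin, hq0]
  have hdim : (IntermediateField.adjoin.powerBasis hint).dim = 4 := by
    rw [IntermediateField.adjoin.powerBasis_dim, hmin, hqdeg]
  rw [hdim]; norm_num

/-! ## §2 `−1 ∈ N_{K_2/K} K_2ˣ` -/

/-- ★★ **`−1` is a norm from the second layer `K_2` of every cyclotomic `ℤ₂`-extension of an odd-degree number field `K`** — in Chevalley's currency:
`unitsIncl K K_2 (−1)` lies in the image of `Herbrand.norm Gal(K_2/K)` on `K_2ˣ`.  Witness `1 − θ` with `θ⁴ − 4θ² + 2 = 0` (`K_2 ∋ θ`), `∏_σ σ(1 − θ) =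
N_{K_2/K}(1 − θ) = −1`. [cite: Washington1997, §13.1 (`K_2 = K·ℚ(ζ₁₆)⁺`)] [cite: Lang1990, Ch. 13 §4, Lemma 4.1 (the unit norm index)] -/
theorem neg_one_mem_map_norm_layer_two (hK : ¬ 2 ∣ Module.finrank ℚ K) (κ : ZpExtension K 2) (hκ : κ.IsCyclotomic)
    [NumberField (κ.layer 2)] :
    unitsIncl K (κ.layer 2) (-1) ∈ (⊤ : Subgroup (κ.layer 2)ˣ).map (Herbrand.norm ((κ.layer 2) ≃ₐ[K] (κ.layer 2))) := by
  classical
  haveI : IsGalois K (κ.layer 2) := κ.isGalois_layer_holds 2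
  have hodd : Odd (Module.finrank ℚ K) := Nat.odd_iff.mpr (Nat.two_dvd_ne_zero.mp hK)
  have hL : Module.finrank K (κ.layer 2) = 4 := by rw [κ.finrank_layer_holds 2]; norm_num
  obtain ⟨θ, hθ⟩ := exists_quartic_root_layer_two_of_not_dvd_finrank hK κ hκ
  have hnorm := Algebra.norm_one_sub_eq_neg_one_of_quartic_root hodd hL θ hθ
  have hne : (1 : κ.layer 2) - θ ≠ 0 := by
    intro h
    have : Algebra.norm K ((1 : κ.layer 2) - θ) = 0 := by rw [h, Algebra.norm_zero]
    rw [hnorm] at this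
    exact absurd this (by norm_num)
  refine ⟨Units.mk0 _ hne, Subgroup.mem_top _, ?_⟩
  apply Units.ext
  rw [Herbrand.norm_apply, Units.coe_prod]
  simp only [val_smul, Units.val_mk0, coe_unitsIncl, Units.val_neg, Units.val_one, map_neg, map_one]
  rw [← Algebra.norm_eq_prod_automorphisms, hnorm, map_neg, map_one]

end Literature.NumberTheory.IwasawaTheory

end
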